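import Literature.NumberTheory.Sieve.FriedlanderIwaniecPrimesBilinearPartition
import Mathlib.Algebra.Order.ToIntervalMod
import HarnessLib

/-!
# Friedlander–Iwaniec, *The polynomial `X² + Y⁴` captures its primes*, §5: the smooth partition of the circle (5.12)–(5.13)

Family `parity`, statement parity.S17 (`setOf_prime_sq_add_pow_four_infinite`). Source: J. Friedlander,
H. Iwaniec, Ann. of Math. (2) 148 (1998), 945–1040 [FriedlanderIwaniecAnnals1998], §5, (5.12)–(5.13):
"Next we are going to assume that `β_z` is supported in a narrow sector (5.12)
`φ < arg z ≤ φ + 2πθ` for some `-π < φ < π` where `θ` is the same as in (4.12). This can be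
accomplished by splitting according to a smooth partition of unity (without any residual
contribution because there is no boundary). We need only a `C²`-class partition. In other words we
attach to `β_z` a periodic function `q(α)` of period `2π` supported on `φ < α ≤ φ + 2πθ` such that
`q^{(j)} ≪ θ^{-j}`, `j = 0, 1, 2`."

This file CONSTRUCTS such a partition of the circle explicitly and proves its properties, for the
reduction of `FriedlanderIwaniec1998_bilinear423` ((4.23)) to the sector bound (5.15) of the source
(the sector forms `B(M, N)` are `fiGaussSector`, `FriedlanderIwaniecPrimesGaussianSector`); the
requirements of (5.12)–(5.13) on `q` (period `2π`, class `C²`, support on an arc of width `2πθ`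
modulo `2π`, and, normalised, `|q| ≤ 1`, `|q'| ≤ θ⁻¹`, `|q''| ≤ θ⁻²`) are met by the pieces below
after division by `2M_ψ`.

## Construction and contents (everything proved)

* `angPeriodize c f` — `2π`-periodisation of `f : ℝ → ℝ` through the window `(c, c + 2π]`
  (`toIocMod`), for `f` supported strictly inside the window (`WindowSupp c μ f`): locally it is a
  translate of `f` (`angPeriodize_eventuallyEq`), hence as smooth as `f` (`contDiff_angPeriodize`)
  with `(angPeriodize c f)⁽ʲ⁾ = f⁽ʲ⁾ ∘ (· mod 2π)` (`deriv_angPeriodize`, `deriv_deriv_angPeriodize`),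
  and `angPeriodize c f (v) = f(v + 2π) + f(v) + f(v - 2π)` on a triple window
  (`angPeriodize_eq_three`);
* the arcs: `J = angCount θ = ⌈2/θ⌉` (`≤ 3/θ`), spacing `Δ = angΔ θ = 2π/J ∈ [2πθ/3, πθ]`, starts
  `φ_j = angStart θ j = -π + jΔ`, bumps `b_j = angBump θ j = fiBump φ_j Δ` (support
  `(φ_j, φ_j + 2Δ) ⊆ (φ_j, φ_j + 2πθ]`) and pieces `q_j = angPiece θ j` = the periodisation of `b_j`
  through the window centred at it;
* for `0 < θ ≤ 1/2`: `q_j` is `2π`-periodic and smooth (`angPiece_periodic`, `contDiff_angPiece`),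
  `0 ≤ q_j ≤ 1` (`angPiece_nonneg`, `abs_angPiece_le_one`), `|q_j'| ≤ 2M_ψ θ⁻¹`,
  `|q_j''| ≤ 2M_ψ θ⁻²` (`abs_deriv_angPiece_le`, `abs_deriv_deriv_angPiece_le`; `M_ψ` a bound for
  `|ψ'|, |ψ''|` as in `exists_bound_deriv_smoothTransition`), `q_j(u) ≠ 0` only for
  `u ∈ (φ_j, φ_j + 2πθ]` modulo `2π` (`angPiece_support`), and **`Σ_{j < J} q_j = 1` everywhere**
  (`sum_angPiece`: on `(-π, π]` the three copies telescope through `sum_range_fiBump`, and the sum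
  is periodic).

## References

* J. Friedlander, H. Iwaniec, Ann. of Math. (2) 148 (1998), 945–1040, §5 (5.12)–(5.14).
  [FriedlanderIwaniecAnnals1998]

## Tree / Mathlib

Tree: `fiBump`, `fiStep`, `fiBump_support`, `fiBump_nonneg`, `abs_fiBump_le_one`, `contDiff_fiBump`,
`abs_deriv_fiBump_le`, `abs_deriv_deriv_fiBump_le`, `sum_range_fiBump`, `fiStep_eq_one`,
`fiStep_eq_zero` (`FriedlanderIwaniecPrimesBilinearPartition`). Mathlib: `toIocMod`, `toIocDiv`,
`toIocMod_eq_iff`, `toIocMod_add_toIocDiv_zsmul`, `Function.Periodic`, `deriv_comp_sub_const`,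
`ContDiffAt.congr_of_eventuallyEq`. Mathlib's `AddCircle`/`Real.Angle` smooth structures are not
used: (5.13) evaluates an ordinary periodic function `q` at `arg z`.
-/

noncomputable section

open Real Filter Finset
open scoped Topology

namespace Literature.NumberTheory.Sieve.FriedlanderIwaniecPrimes

/-! ### Periodisation through a window `(c, c + 2π]` -/

/-- `2π`-periodisation of `f` through the window `(c, c + 2π]`: `u ↦ f(u mod 2π ∈ (c, c + 2π])`.
[folklore] -/
def angPeriodize (c : ℝ) (f : ℝ → ℝ) (u : ℝ) : ℝ := f (toIocMod Real.two_pi_pos c u)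

/-- `angPeriodize c f` has period `2π`. [folklore] -/
theorem angPeriodize_periodic (c : ℝ) (f : ℝ → ℝ) : Function.Periodic (angPeriodize c f) (2 * π) :=
  fun u => by simp only [angPeriodize, toIocMod_add_right]

/-- `f` vanishes outside `(c + μ, c + 2π - μ)` (a support strictly inside the window). [folklore] -/
def WindowSupp (c μ : ℝ) (f : ℝ → ℝ) : Prop := ∀ v, f v ≠ 0 → c + μ < v ∧ v < c + 2 * π - μ

/-- `f = 0` left of the inner window. [folklore] -/
theorem WindowSupp.eq_zero_of_le {c μ : ℝ} {f : ℝ → ℝ} (h : WindowSupp c μ f) {v : ℝ} (hv : v ≤ c + μ) :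
    f v = 0 := by
  by_contra hne; exact absurd (h v hne).1 (not_lt.mpr hv)

/-- `f = 0` right of the inner window. [folklore] -/
theorem WindowSupp.eq_zero_of_ge {c μ : ℝ} {f : ℝ → ℝ} (h : WindowSupp c μ f) {v : ℝ}
    (hv : c + 2 * π - μ ≤ v) : f v = 0 := by
  by_contra hne; exact absurd (h v hne).2 (not_lt.mpr hv)

/-- Shrinking the margin. [folklore] -/
theorem WindowSupp.mono {c μ μ' : ℝ} {f : ℝ → ℝ} (h : WindowSupp c μ f) (hμ : μ' ≤ μ) :
    WindowSupp c μ' f := fun v hv => by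
  have := h v hv; constructor <;> linarith

/-- **Locally, the periodisation is a translate of `f`**: near `x`,
`angPeriodize c f = f(· - k·2π)` with `k = toIocDiv c x` (at the seams both sides vanish).
[folklore] -/
theorem angPeriodize_eventuallyEq {c μ : ℝ} {f : ℝ → ℝ} (hμ : 0 < μ) (hμπ : μ ≤ π)
    (h : WindowSupp c μ f) (x : ℝ) :
    angPeriodize c f =ᶠ[𝓝 x] fun u => f (u - toIocDiv Real.two_pi_pos c x • (2 * π)) := by
  have hπ := Real.pi_pos
  set k := toIocDiv Real.two_pi_pos c x with hk
  set m := toIocMod Real.two_pi_pos c x with hm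
  have hxm : m + k • (2 * π) = x := toIocMod_add_toIocDiv_zsmul _ _ _
  have hmI := toIocMod_mem_Ioc Real.two_pi_pos c x
  rw [← hm] at hmI
  filter_upwards [Metric.ball_mem_nhds x hμ] with u hu
  rw [Metric.mem_ball, Real.dist_eq] at hu
  set v := u - k • (2 * π) with hv
  have hvm : |v - m| < μ := by
    have : v - m = u - x := by rw [hv, ← hxm]; ring
    rw [this]; exact hu
  simp only [angPeriodize]
  rcases lt_or_ge (c + 2 * π) v with hbig | hle
  · -- `v` just above the window: both sides vanish
    have hv2 : v < c + 2 * π + μ := by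
      have := (abs_lt.mp hvm).2; have := hmI.2; linarith
    have ht : toIocMod Real.two_pi_pos c u = v - 2 * π := by
      rw [toIocMod_eq_iff]
      refine ⟨⟨by linarith, by linarith⟩, k + 1, ?_⟩
      rw [hv, add_zsmul, one_zsmul]; ring
    rw [ht, h.eq_zero_of_le (by linarith), h.eq_zero_of_ge (by linarith)]
  rcases le_or_gt v c with hsmall | hgt
  · -- `v` just below the window: both sides vanish
    have hv2 : c - μ < v := by
      have := (abs_lt.mp hvm).1; have := hmI.1; linarith
    have ht : toIocMod Real.two_pi_pos c u = v + 2 * π := by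
      rw [toIocMod_eq_iff]
      refine ⟨⟨by linarith, by linarith⟩, k - 1, ?_⟩
      rw [hv, sub_zsmul, one_zsmul]; ring
    rw [ht, h.eq_zero_of_ge (by linarith), h.eq_zero_of_le (by linarith)]
  · -- `v` inside the window: the reduction is `v`
    have ht : toIocMod Real.two_pi_pos c u = v := by
      rw [toIocMod_eq_iff]
      exact ⟨⟨hgt, hle⟩, k, by rw [hv]; ring⟩
    rw [ht]

/-- The periodisation of a `C^n` function supported inside the window is `C^n`. [folklore] -/
theorem contDiff_angPeriodize {c μ : ℝ} {f : ℝ → ℝ} (hμ : 0 < μ) (hμπ : μ ≤ π) (h : WindowSupp c μ f)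
    {n : ℕ∞} (hf : ContDiff ℝ n f) : ContDiff ℝ n (angPeriodize c f) := by
  rw [contDiff_iff_contDiffAt]
  intro x
  have htr : ContDiff ℝ n (fun u => f (u - toIocDiv Real.two_pi_pos c x • (2 * π))) :=
    hf.comp (contDiff_id.sub contDiff_const)
  exact htr.contDiffAt.congr_of_eventuallyEq (angPeriodize_eventuallyEq hμ hμπ h x)

/-- **Derivative of the periodisation**: `(angPeriodize c f)' (x) = f'(x mod 2π)`. [folklore] -/
theorem deriv_angPeriodize {c μ : ℝ} {f : ℝ → ℝ} (hμ : 0 < μ) (hμπ : μ ≤ π) (h : WindowSupp c μ f)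
    (x : ℝ) : deriv (angPeriodize c f) x = deriv f (toIocMod Real.two_pi_pos c x) := by
  rw [(angPeriodize_eventuallyEq hμ hμπ h x).deriv_eq, deriv_comp_sub_const,
    ← toIocMod_add_toIocDiv_zsmul Real.two_pi_pos c x]
  simp

/-- As functions: `(angPeriodize c f)' = angPeriodize c f'`. [folklore] -/
theorem deriv_angPeriodize_eq {c μ : ℝ} {f : ℝ → ℝ} (hμ : 0 < μ) (hμπ : μ ≤ π) (h : WindowSupp c μ f) :
    deriv (angPeriodize c f) = angPeriodize c (deriv f) :=
  funext fun x => deriv_angPeriodize hμ hμπ h x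

/-- The derivative of `f` is supported inside the window too (with half the margin). [folklore] -/
theorem WindowSupp.deriv {c μ : ℝ} {f : ℝ → ℝ} (hμ : 0 < μ) (h : WindowSupp c μ f) :
    WindowSupp c (μ / 2) (deriv f) := by
  intro v hv
  by_contra hc
  rw [not_and_or, not_lt, not_lt] at hc
  apply hv
  rcases hc with hc | hc
  · have hzero : f =ᶠ[𝓝 v] fun _ => (0 : ℝ) := by
      filter_upwards [Iio_mem_nhds (show v < c + μ by linarith)] with u hu
      exact h.eq_zero_of_le (le_of_lt hu)
    rw [hzero.deriv_eq, deriv_const]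
  · have hzero : f =ᶠ[𝓝 v] fun _ => (0 : ℝ) := by
      filter_upwards [Ioi_mem_nhds (show c + 2 * π - μ < v by linarith)] with u hu
      exact h.eq_zero_of_ge (le_of_lt hu)
    rw [hzero.deriv_eq, deriv_const]

/-- **Second derivative of the periodisation**: `(angPeriodize c f)''(x) = f''(x mod 2π)`. [folklore] -/
theorem deriv_deriv_angPeriodize {c μ : ℝ} {f : ℝ → ℝ} (hμ : 0 < μ) (hμπ : μ ≤ π)
    (h : WindowSupp c μ f) (x : ℝ) :
    deriv (deriv (angPeriodize c f)) x = deriv (deriv f) (toIocMod Real.two_pi_pos c x) := by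
  rw [deriv_angPeriodize_eq hμ hμπ h]
  exact deriv_angPeriodize (half_pos hμ) (by linarith) (h.deriv hμ) x

/-- Values of the periodisation are values of `f`. [folklore] -/
theorem abs_angPeriodize_le {c : ℝ} {f : ℝ → ℝ} {B : ℝ} (hB : ∀ v, |f v| ≤ B) (u : ℝ) :
    |angPeriodize c f u| ≤ B := hB _

/-- Nonnegativity passes to the periodisation. [folklore] -/
theorem angPeriodize_nonneg {c : ℝ} {f : ℝ → ℝ} (hf : ∀ v, 0 ≤ f v) (u : ℝ) : 0 ≤ angPeriodize c f u :=
  hf _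

/-- The support of the periodisation: `angPeriodize c f u ≠ 0` gives `f(u - 2πk) ≠ 0` for the
reduction `u - 2πk ∈ (c, c + 2π]`. [folklore] -/
theorem exists_of_angPeriodize_ne_zero {c : ℝ} {f : ℝ → ℝ} {u : ℝ} (hu : angPeriodize c f u ≠ 0) :
    ∃ k : ℤ, f (u - 2 * π * k) ≠ 0 ∧ u - 2 * π * k ∈ Set.Ioc c (c + 2 * π) := by
  refine ⟨toIocDiv Real.two_pi_pos c u, ?_, ?_⟩
  · have e : u - 2 * π * (toIocDiv Real.two_pi_pos c u : ℝ) = toIocMod Real.two_pi_pos c u := by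
      rw [← self_sub_toIocDiv_zsmul, zsmul_eq_mul]; ring
    rw [e]; exact hu
  · have e : u - 2 * π * (toIocDiv Real.two_pi_pos c u : ℝ) = toIocMod Real.two_pi_pos c u := by
      rw [← self_sub_toIocDiv_zsmul, zsmul_eq_mul]; ring
    rw [e]; exact toIocMod_mem_Ioc _ _ _

/-- **Three copies**: for `v ∈ (c - 2π, c + 4π]`,
`angPeriodize c f v = f(v + 2π) + f(v) + f(v - 2π)` (exactly one copy lies in the window; the others
vanish). [folklore] -/
theorem angPeriodize_eq_three {c μ : ℝ} {f : ℝ → ℝ} (h : WindowSupp c μ f) (hμ : 0 ≤ μ) {v : ℝ}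
    (hv1 : c - 2 * π < v) (hv2 : v ≤ c + 4 * π) :
    angPeriodize c f v = f (v + 2 * π) + f v + f (v - 2 * π) := by
  have hπ := Real.pi_pos
  simp only [angPeriodize]
  rcases le_or_gt v c with h1 | h1
  · -- copy `v + 2π`
    have ht : toIocMod Real.two_pi_pos c v = v + 2 * π := by
      rw [toIocMod_eq_iff]; exact ⟨⟨by linarith, by linarith⟩, -1, by simp⟩
    rw [ht, h.eq_zero_of_le (v := v) (by linarith), h.eq_zero_of_le (v := v - 2 * π) (by linarith)]
    ring
  rcases le_or_gt v (c + 2 * π) with h2 | h2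
  · have ht : toIocMod Real.two_pi_pos c v = v := by
      rw [toIocMod_eq_iff]; exact ⟨⟨h1, h2⟩, 0, by simp⟩
    rw [ht, h.eq_zero_of_ge (v := v + 2 * π) (by linarith), h.eq_zero_of_le (v := v - 2 * π) (by linarith)]
    ring
  · have ht : toIocMod Real.two_pi_pos c v = v - 2 * π := by
      rw [toIocMod_eq_iff]; exact ⟨⟨by linarith, by linarith⟩, 1, by simp⟩
    rw [ht, h.eq_zero_of_ge (v := v + 2 * π) (by linarith), h.eq_zero_of_ge (v := v) (by linarith)]
    ring


/-! ### The partition of the circle into arcs of width `≤ 2πθ` -/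

/-- The number of arcs `J = ⌈2/θ⌉`. [cite: FriedlanderIwaniecAnnals1998, (5.12)] -/
def angCount (θ : ℝ) : ℕ := ⌈2 / θ⌉₊

/-- The spacing `Δ = 2π/J` of the arcs. [folklore] -/
def angΔ (θ : ℝ) : ℝ := 2 * π / angCount θ

/-- The start `φ_j = -π + jΔ` of the `j`-th arc. [cite: FriedlanderIwaniecAnnals1998, (5.12)] -/
def angStart (θ : ℝ) (j : ℕ) : ℝ := -π + j * angΔ θ

/-- The window `(c_j, c_j + 2π]`, `c_j = φ_j + Δ - π`, centred at the `j`-th bump. [folklore] -/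
def angWindow (θ : ℝ) (j : ℕ) : ℝ := angStart θ j + angΔ θ - π

/-- The `j`-th bump `b_j = fiBump φ_j Δ` on the line (support `(φ_j, φ_j + 2Δ)`). [folklore] -/
def angBump (θ : ℝ) (j : ℕ) : ℝ → ℝ := fiBump (angStart θ j) (angΔ θ)

/-- The `j`-th angular partition function `q_j`: the `2π`-periodisation of `b_j` (FI's `q(α)` of
(5.12)–(5.13) for the sector `(φ_j, φ_j + 2πθ]`). [cite: FriedlanderIwaniecAnnals1998, (5.12)-(5.13)] -/
def angPiece (θ : ℝ) (j : ℕ) : ℝ → ℝ := angPeriodize (angWindow θ j) (angBump θ j)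

section

variable {θ : ℝ}

/-- `J ≥ 4` for `θ ≤ 1/2`. [folklore] -/
theorem four_le_angCount (hθ : 0 < θ) (hθ1 : θ ≤ 1 / 2) : 4 ≤ angCount θ := by
  unfold angCount
  have h : (4 : ℝ) ≤ 2 / θ := by rw [le_div_iff₀ hθ]; linarith
  have := Nat.le_ceil (2 / θ)
  have h4 : (4 : ℝ) ≤ (⌈2 / θ⌉₊ : ℕ) := h.trans this
  exact_mod_cast h4

/-- `J ≥ 2/θ`. [folklore] -/
theorem two_div_le_angCount (θ : ℝ) : 2 / θ ≤ (angCount θ : ℝ) := Nat.le_ceil _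

/-- `J ≤ 3/θ` for `θ ≤ 1`. [folklore] -/
theorem angCount_le (hθ : 0 < θ) (hθ1 : θ ≤ 1) : (angCount θ : ℝ) ≤ 3 / θ := by
  unfold angCount
  have h1 := Nat.ceil_lt_add_one (show (0 : ℝ) ≤ 2 / θ by positivity)
  have h2 : (1 : ℝ) ≤ 1 / θ := by rw [le_div_iff₀ hθ]; linarith
  have : 2 / θ + 1 ≤ 3 / θ := by rw [div_add_one hθ.ne', div_le_div_iff_of_pos_right hθ]; linarith
  linarith

/-- `J > 0`. [folklore] -/
theorem angCount_pos (hθ : 0 < θ) (hθ1 : θ ≤ 1 / 2) : 0 < angCount θ :=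
  lt_of_lt_of_le (by norm_num) (four_le_angCount hθ hθ1)

/-- `Δ > 0`. [folklore] -/
theorem angΔ_pos (hθ : 0 < θ) (hθ1 : θ ≤ 1 / 2) : 0 < angΔ θ := by
  unfold angΔ
  have := angCount_pos hθ hθ1
  have hπ := Real.pi_pos
  positivity

/-- `Δ ≤ πθ` (so that `2Δ ≤ 2πθ`). [folklore] -/
theorem angΔ_le (hθ : 0 < θ) (hθ1 : θ ≤ 1 / 2) : angΔ θ ≤ π * θ := by
  unfold angΔ
  have hJ : (0 : ℝ) < angCount θ := by exact_mod_cast angCount_pos hθ hθ1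
  rw [div_le_iff₀ hJ]
  have h := two_div_le_angCount θ
  rw [div_le_iff₀ hθ] at h
  nlinarith [Real.pi_pos]

/-- `Δ ≥ 2πθ/3`. [folklore] -/
theorem angΔ_ge (hθ : 0 < θ) (hθ1 : θ ≤ 1 / 2) : 2 * π * θ / 3 ≤ angΔ θ := by
  unfold angΔ
  have hJ : (0 : ℝ) < angCount θ := by exact_mod_cast angCount_pos hθ hθ1
  have h := angCount_le hθ (by linarith)
  rw [le_div_iff₀ hθ] at h
  rw [div_le_div_iff₀ (by norm_num : (0 : ℝ) < 3) hJ]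
  have hπ := Real.pi_pos
  calc 2 * π * θ * (angCount θ : ℝ) = 2 * π * ((angCount θ : ℝ) * θ) := by ring
    _ ≤ 2 * π * 3 := mul_le_mul_of_nonneg_left h (by positivity)

/-- `Δ ≤ π/2`. [folklore] -/
theorem angΔ_le_half_pi (hθ : 0 < θ) (hθ1 : θ ≤ 1 / 2) : angΔ θ ≤ π / 2 := by
  have := angΔ_le hθ hθ1
  nlinarith [Real.pi_pos]

/-- `JΔ = 2π`, i.e. `-π + JΔ = π`. [folklore] -/
theorem angStart_angCount (hθ : 0 < θ) (hθ1 : θ ≤ 1 / 2) : angStart θ (angCount θ) = π := by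
  unfold angStart angΔ
  have hJ : (angCount θ : ℝ) ≠ 0 := by exact_mod_cast (angCount_pos hθ hθ1).ne'
  field_simp
  ring

/-- The bumps sit inside their windows with margin `π - Δ`. [folklore] -/
theorem windowSupp_angBump (hθ : 0 < θ) (hθ1 : θ ≤ 1 / 2) (j : ℕ) :
    WindowSupp (angWindow θ j) (π - angΔ θ) (angBump θ j) := by
  intro v hv
  have h := fiBump_support (angΔ_pos hθ hθ1) hv
  unfold angWindow
  constructor <;> linarith [h.1, h.2]

/-- The margin `π - Δ` is positive. [folklore] -/
theorem margin_pos (hθ : 0 < θ) (hθ1 : θ ≤ 1 / 2) : 0 < π - angΔ θ := by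
  have := angΔ_le_half_pi hθ hθ1; linarith [Real.pi_pos]

/-- The margin is at most `π`. [folklore] -/
theorem margin_le (hθ : 0 < θ) (hθ1 : θ ≤ 1 / 2) : π - angΔ θ ≤ π := by
  linarith [angΔ_pos hθ hθ1]

/-- `q_j` is `2π`-periodic. [cite: FriedlanderIwaniecAnnals1998, (5.12)] -/
theorem angPiece_periodic (θ : ℝ) (j : ℕ) : Function.Periodic (angPiece θ j) (2 * π) :=
  angPeriodize_periodic _ _

/-- `q_j` is smooth ("We need only a `C²`-class partition"). [cite: FriedlanderIwaniecAnnals1998, (5.12)] -/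
theorem contDiff_angPiece (hθ : 0 < θ) (hθ1 : θ ≤ 1 / 2) (j : ℕ) {n : ℕ∞} :
    ContDiff ℝ n (angPiece θ j) :=
  contDiff_angPeriodize (margin_pos hθ hθ1) (margin_le hθ hθ1) (windowSupp_angBump hθ hθ1 j)
    (contDiff_fiBump _ _)

/-- `0 ≤ q_j`. [folklore] -/
theorem angPiece_nonneg (hθ : 0 < θ) (hθ1 : θ ≤ 1 / 2) (j : ℕ) (u : ℝ) : 0 ≤ angPiece θ j u :=
  angPeriodize_nonneg (fiBump_nonneg (angΔ_pos hθ hθ1)) u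

/-- `|q_j| ≤ 1` ((5.12) with `j = 0`). [cite: FriedlanderIwaniecAnnals1998, (5.12)] -/
theorem abs_angPiece_le_one (hθ : 0 < θ) (hθ1 : θ ≤ 1 / 2) (j : ℕ) (u : ℝ) : |angPiece θ j u| ≤ 1 :=
  abs_angPeriodize_le (abs_fiBump_le_one (angΔ_pos hθ hθ1)) u

/-- **`|q_j'| ≤ 2 M_ψ θ⁻¹`** ("`q^{(j)} ≪ θ^{-j}`", `j = 1`; `M_ψ` bounds `|ψ'|, |ψ''|`). [cite: FriedlanderIwaniecAnnals1998, (5.12)] -/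
theorem abs_deriv_angPiece_le {Mψ : ℝ} (hM : ∀ s, |deriv Real.smoothTransition s| ≤ Mψ) (hM0 : 0 ≤ Mψ)
    (hθ : 0 < θ) (hθ1 : θ ≤ 1 / 2) (j : ℕ) (u : ℝ) :
    |deriv (angPiece θ j) u| ≤ 2 * Mψ * θ⁻¹ := by
  have hΔ := angΔ_pos hθ hθ1
  rw [angPiece, deriv_angPeriodize (margin_pos hθ hθ1) (margin_le hθ hθ1) (windowSupp_angBump hθ hθ1 j)]
  refine (abs_deriv_fiBump_le hM _ hΔ _).trans ?_
  -- `2M/Δ ≤ 2M/(2πθ/3) = 3M/(πθ) ≤ 2M/θ` since `π ≥ 2`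
  have hge := angΔ_ge hθ hθ1
  have hπ := Real.two_le_pi
  rw [div_le_iff₀ hΔ]
  have h1 : 2 * Mψ * θ⁻¹ * (2 * π * θ / 3) ≤ 2 * Mψ * θ⁻¹ * angΔ θ :=
    mul_le_mul_of_nonneg_left hge (by positivity)
  have h2 : 2 * Mψ * θ⁻¹ * (2 * π * θ / 3) = Mψ * (4 * π / 3) := by field_simp; ring
  nlinarith

/-- **`|q_j''| ≤ 2 M_ψ θ⁻²`** (`j = 2`). [cite: FriedlanderIwaniecAnnals1998, (5.12)] -/
theorem abs_deriv_deriv_angPiece_le {Mψ : ℝ} (hM : ∀ s, |deriv (deriv Real.smoothTransition) s| ≤ Mψ)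
    (hM0 : 0 ≤ Mψ) (hθ : 0 < θ) (hθ1 : θ ≤ 1 / 2) (j : ℕ) (u : ℝ) :
    |deriv (deriv (angPiece θ j)) u| ≤ 2 * Mψ * θ⁻¹ ^ 2 := by
  have hΔ := angΔ_pos hθ hθ1
  rw [angPiece, deriv_deriv_angPeriodize (margin_pos hθ hθ1) (margin_le hθ hθ1)
    (windowSupp_angBump hθ hθ1 j)]
  refine (abs_deriv_deriv_fiBump_le hM _ hΔ _).trans ?_
  -- `2M/Δ² ≤ 2M·9/(4π²θ²) ≤ 2M/θ²` since `4π² ≥ 9`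
  have hge := angΔ_ge hθ hθ1
  have hπ := Real.two_le_pi
  have hΔ2 : (2 * π * θ / 3) ^ 2 ≤ angΔ θ ^ 2 := pow_le_pow_left₀ (by positivity) hge 2
  rw [div_le_iff₀ (by positivity)]
  have h1 : 2 * Mψ * θ⁻¹ ^ 2 * (2 * π * θ / 3) ^ 2 ≤ 2 * Mψ * θ⁻¹ ^ 2 * angΔ θ ^ 2 :=
    mul_le_mul_of_nonneg_left hΔ2 (by positivity)
  have h2 : 2 * Mψ * θ⁻¹ ^ 2 * (2 * π * θ / 3) ^ 2 = Mψ * (8 * π ^ 2 / 9) := by field_simp; ring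
  have hπ2 : 4 ≤ π ^ 2 := by nlinarith
  have h3 : 2 * Mψ ≤ Mψ * (8 * π ^ 2 / 9) := by
    have := mul_le_mul_of_nonneg_left hπ2 hM0
    nlinarith
  linarith

/-- **Support**: `q_j(u) ≠ 0` only on the arc `(φ_j, φ_j + 2πθ]` modulo `2π`. [cite: FriedlanderIwaniecAnnals1998, (5.12)] -/
theorem angPiece_support (hθ : 0 < θ) (hθ1 : θ ≤ 1 / 2) {j : ℕ} {u : ℝ} (hu : angPiece θ j u ≠ 0) :
    ∃ k : ℤ, angStart θ j < u - 2 * π * k ∧ u - 2 * π * k ≤ angStart θ j + 2 * π * θ := by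
  obtain ⟨k, hk, -⟩ := exists_of_angPeriodize_ne_zero hu
  have h := fiBump_support (angΔ_pos hθ hθ1) hk
  have hΔ := angΔ_le hθ hθ1
  exact ⟨k, h.1, by linarith [h.2]⟩

/-- The sum of the bumps on the line: `Σ_{j<J} b_j(y) = S(y) - S(y - 2π)`, `S = fiStep (-π) Δ`. [folklore] -/
theorem sum_angBump (hθ : 0 < θ) (hθ1 : θ ≤ 1 / 2) (y : ℝ) :
    ∑ j ∈ range (angCount θ), angBump θ j y =
      fiStep (-π) (angΔ θ) y - fiStep (-π) (angΔ θ) (y - 2 * π) := by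
  have h := sum_range_fiBump (-π) (angΔ θ) y (angCount θ)
  have e : ∀ j : ℕ, fiBump (-π + j * angΔ θ) (angΔ θ) y = angBump θ j y := fun j => rfl
  simp only [e] at h
  rw [h]
  have hJ : -π + (angCount θ : ℝ) * angΔ θ = π := angStart_angCount hθ hθ1
  rw [hJ]
  simp only [fiStep]
  congr 2
  ring

/-- **The partition sums to one** on `(-π, π]` (three copies of each bump; the bumps telescope). [folklore] -/
theorem sum_angPiece_of_mem (hθ : 0 < θ) (hθ1 : θ ≤ 1 / 2) {v : ℝ} (hv1 : -π < v) (hv2 : v ≤ π) :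
    ∑ j ∈ range (angCount θ), angPiece θ j v = 1 := by
  have hπ := Real.pi_pos
  have hΔ := angΔ_pos hθ hθ1
  have hΔ2 := angΔ_le_half_pi hθ hθ1
  -- three copies for each `j`
  have h3 : ∀ j ∈ range (angCount θ), angPiece θ j v =
      angBump θ j (v + 2 * π) + angBump θ j v + angBump θ j (v - 2 * π) := by
    intro j hj
    rw [mem_range] at hj
    have hjr : (j : ℝ) + 1 ≤ angCount θ := by exact_mod_cast hj
    have hc1 : angWindow θ j ≤ 0 := by
      unfold angWindow angStart
      have : ((j : ℝ) + 1) * angΔ θ ≤ angCount θ * angΔ θ := mul_le_mul_of_nonneg_right hjr hΔ.le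
      have hJ : (angCount θ : ℝ) * angΔ θ = 2 * π := by
        have := angStart_angCount hθ hθ1; unfold angStart at this; linarith
      nlinarith
    have hc2 : -2 * π ≤ angWindow θ j := by
      unfold angWindow angStart
      have : (0 : ℝ) ≤ j * angΔ θ := by positivity
      linarith
    exact angPeriodize_eq_three (windowSupp_angBump hθ hθ1 j) (margin_pos hθ hθ1).le
      (by linarith) (by linarith)
  rw [sum_congr rfl h3, sum_add_distrib, sum_add_distrib, sum_angBump hθ hθ1, sum_angBump hθ hθ1,
    sum_angBump hθ hθ1]
  have e1 : v + 2 * π - 2 * π = v := by ring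
  have e2 : v - 2 * π - 2 * π = v - 4 * π := by ring
  rw [e1, e2, fiStep_eq_one hΔ (show -π + angΔ θ ≤ v + 2 * π by linarith),
    fiStep_eq_zero hΔ (show v - 4 * π ≤ -π by linarith)]
  ring

/-- **The partition sums to one** everywhere ("a smooth partition of unity (without any residual
contribution because there is no boundary)"). [cite: FriedlanderIwaniecAnnals1998, (5.12)] -/
theorem sum_angPiece (hθ : 0 < θ) (hθ1 : θ ≤ 1 / 2) (u : ℝ) :
    ∑ j ∈ range (angCount θ), angPiece θ j u = 1 := by
  set v := toIocMod Real.two_pi_pos (-π) u with hv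
  have hvI := toIocMod_mem_Ioc Real.two_pi_pos (-π) u
  rw [← hv] at hvI
  have hvu : v + toIocDiv Real.two_pi_pos (-π) u • (2 * π) = u := toIocMod_add_toIocDiv_zsmul _ _ _
  have hper : ∀ j, angPiece θ j u = angPiece θ j v := by
    intro j
    rw [← hvu]
    exact (angPiece_periodic θ j).zsmul _ v
  simp only [hper]
  exact sum_angPiece_of_mem hθ hθ1 hvI.1 (by linarith [hvI.2])

end

end Literature.NumberTheory.Sieve.FriedlanderIwaniecPrimes
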